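import Literature.MathematicalPhysics.QuantumLattice.HubbardNNNHoppingRectTorusPlaquetteDressedBound
import HarnessLib

/-!
# The plaquette-dressed Slater bound on the even SQUARE torus `(ℤ/2M)²` with `t–t'` hopping

Topic `MathematicalPhysics/QuantumLattice`, family `hubbard`. The square-torus (`FermionTorus 2 (M * 2)`,
sites `Fin 2 → Fin (2M)`, adjacency through `ZMod (2M)`) companion of
`HubbardNNNHoppingRectTorusPlaquetteDressedBound.lean` (rectangular presentation `Fin (2M) ×ₗ Fin (2M')`)
and the `t–t'` companion of `HubbardTorusPlaquetteDressedBound.lean` (square torus, `t' = 0`): the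
dressed-cluster variational bound `DressedCluster.groundEnergy_le` instantiated for the `t–t'` Hamiltonian
`hubbardTorusTT' (M * 2) t t' U` (`HubbardNNNHopping.lean`), tiled by the `M²` disjoint `2 × 2` plaquettes
of the square file (charts `cellEmb c`, `c : Fin 2 → Fin M`; axial link charts `linkEmb hM c e` made of the
plaquettes `c`, `c + e`). WHY A SECOND PRESENTATION: the thermodynamic-limit chain of the plaquette-dressed
quasi-free certificates (`Summits/Ventures/CertifiedManyBodySolver/Upper/BlochDressed*.lean`, ending in
`Upper.energyDensity2D_le_qfpCellEnergy`) is written on the square torus with exactly these charts; its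
`t–t'` twin starts from the present file.

New here (square coordinates):

* `cornerDir d`, `cornerShift c d = c + (1, ±1)`, `cornerSite`/`cornerEmb hM c d` — the CORNER link window
  made of the plaquettes `c` and `c + (1, 1)` (`d = 0`) resp. `c + (1, -1)` (`d = 1`), which carries the single
  diagonal bond between the facing corners (`PlaquetteLUC.cornerGraph d` of the open-box file);
* `ite_diagAdj_cellSite_eq`, `sum_ite_diagAdj_eq` — **tiling of the next-nearest-neighbour bonds of
  `(ℤ/2M)²`** (`M ≥ 2`): every ordered diagonal pair lies in exactly one plaquette
  (`plaquetteDiagGraph`), one axial link (`linkDiagGraph e`, window `linkEmb hM c e`) or one corner link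
  (`cornerGraph d`, window `cornerEmb hM c d`) — proved on representatives by `omega`, as in the
  rectangular file (for `M = 2` the plaquettes `c + (1,1)` and `c + (1,-1)` coincide but the two corner
  bonds do not, and the count is still exact);
* `torusTT'_hamiltonian_eq_sum_cells_add_sum_links` — **bond partition**
  `H_{(ℤ/2M)²}(t,t',U) = Σ_c Γ(cellEmb c)(H_plaq(t,U) + D_plaq(t'))
     + Σ_{(c,e)} Γ(linkEmb c e)(T_e(t) + D_e(t')) + Σ_{(c,d)} Γ(cornerEmb c d) C_d(t')`
  (the nearest-neighbour half is the square file's `hamiltonian_eq_sum_cells_add_sum_links`);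
* `groundEnergy_torusTT'_le_dressed` — **the bound**: for every orthogonal projection `P` with `tr P = N`
  and number-conserving plaquette unitaries `u_c`,
  `E_{(ℤ/2M)²}(t,t',U;N) ≤ Re [ Σ_c ⟨u_cᴴ(H_plaq + D_plaq)u_c⟩_{ρ_P^{cell c}}
     + Σ_{(c,e)} ⟨V_{c,e}ᴴ(T_e + D_e)V_{c,e}⟩_{ρ_P^{link c e}} + Σ_{(c,d)} ⟨W_{c,d}ᴴ C_d W_{c,d}⟩_{ρ_P^{corner c d}} ]`,
  `V_{c,e} = Γ(inl)u_c Γ(inr)u_{c+e}`, `W_{c,d} = Γ(inl)u_c Γ(inr)u_{c+(1,±1)}`, `ρ_P^φ = slaterRDM (P|_φ)`.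

Sources: Bach–Lieb–Solovej 1994, eq. (2c.36) [BachLiebSolovej1994]; Bratteli–Robinson II §5.2.2
[BratteliRobinsonII1997]; LeBlanc et al. 2015, eq. (1) (the `t–t'` model on periodic clusters)
[LeBlancEtAl2015]; the tiling is elementary [folklore]. Everything is proved; definitions have bodies;
no named facts. NOT here: the Bloch-wave / product-mixture / kernel-certificate layers of the
thermodynamic-limit chain (their `t–t'` twins are separate files), and any number.
-/

noncomputable section

namespace Literature.MathematicalPhysics.QuantumLattice

open Matrix Finset HubbardWave0 Literature.Probability.LatticeModels
open scoped ComplexOrder Function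

namespace PlaquetteLUC

variable {M : ℕ}

/-! ### §1. Corner charts of the square torus -/

section Charts

variable [NeZero M]

/-- **The diagonal steps of the plaquette index** `(1, 1)` (`d = 0`) and `(1, -1)` (`d = 1`) of `(ℤ/M)²`:
the relative position, in plaquette units, of two plaquettes of the torus joined by exactly one
next-nearest-neighbour bond `⟨⟨i,j⟩⟩` of LeBlanc et al. (2015), eq. (1). [cite: LeBlancEtAl2015, eq. (1)] -/
def cornerDir (d : Fin 2) : Fin 2 → Fin M := fun i => if i = 0 then 1 else if d = 0 then 1 else -1

/-- The diagonally neighbouring plaquette index `c + (1, ±1)`. [cite: LeBlancEtAl2015, eq. (1)] -/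
def cornerShift (c : Fin 2 → Fin M) (d : Fin 2) : Fin 2 → Fin M := c + cornerDir d

/-- First coordinate of `c + (1, ±1)`: `c₀ + 1`. [cite: LeBlancEtAl2015, eq. (1)] -/
@[simp] theorem cornerShift_apply_zero (c : Fin 2 → Fin M) (d : Fin 2) : cornerShift c d 0 = c 0 + 1 := by
  simp [cornerShift, cornerDir]

/-- Second coordinate of `c + (1, 1)`: `c₁ + 1`. [cite: LeBlancEtAl2015, eq. (1)] -/
@[simp] theorem cornerShift_zero_apply_one (c : Fin 2 → Fin M) : cornerShift c 0 1 = c 1 + 1 := by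
  simp [cornerShift, cornerDir]

/-- Second coordinate of `c + (1, -1)`: `c₁ - 1`. [cite: LeBlancEtAl2015, eq. (1)] -/
@[simp] theorem cornerShift_one_apply_one (c : Fin 2 → Fin M) : cornerShift c 1 1 = c 1 - 1 := by
  simp [cornerShift, cornerDir, sub_eq_add_neg]

/-- In `ℤ/M`, `M ≥ 2`, adding one moves. [folklore] -/
private theorem fin_add_one_ne_self (hM : 2 ≤ M) (x : Fin M) : x + 1 ≠ x := by
  intro h
  have h2 := congrArg Fin.val h
  rw [Fin.val_add, Fin.val_one', Nat.mod_eq_of_lt (by omega : 1 < M)] at h2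
  have hx := x.isLt
  rcases Nat.lt_or_ge ((x : ℕ) + 1) M with hlt | hge
  · rw [Nat.mod_eq_of_lt hlt] at h2; omega
  · have heq : (x : ℕ) + 1 = M := by omega
    rw [heq, Nat.mod_self] at h2; omega

/-- For `M ≥ 2` a plaquette differs from its diagonal neighbours (the first coordinate moves).
[cite: LeBlancEtAl2015, eq. (1)] -/
theorem cornerShift_ne (hM : 2 ≤ M) (c : Fin 2 → Fin M) (d : Fin 2) : cornerShift c d ≠ c := by
  intro h
  have h0 := congrFun h 0
  rw [cornerShift_apply_zero] at h0
  exact fin_add_one_ne_self hM (c 0) h0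

/-- The chart of the CORNER link window made of the plaquettes `c` (first copy) and `c + (1, ±1)`
(second copy): `(i, a) ↦ cellSite (c resp. cornerShift c d) a`. [folklore] -/
def cornerSite (c : Fin 2 → Fin M) (d : Fin 2) (p : Fin 2 ×ₗ FermionTorus 2 2) : FermionTorus 2 (M * 2) :=
  cellSite (if (ofLex p).1 = 0 then c else cornerShift c d) (ofLex p).2

/-- `cornerSite` is injective for `M ≥ 2`. [folklore] -/
private theorem cornerSite_injective (hM : 2 ≤ M) (c : Fin 2 → Fin M) (d : Fin 2) :
    Function.Injective (cornerSite c d) := by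
  intro p q h
  rw [cornerSite, cornerSite, cellSite_inj] at h
  obtain ⟨h1, h2⟩ := h
  have hi : (ofLex p).1 = (ofLex q).1 := by
    by_contra hne
    rcases Fin.eq_zero_or_eq_succ (ofLex p).1 with hp | ⟨k, hk⟩ <;>
      rcases Fin.eq_zero_or_eq_succ (ofLex q).1 with hq | ⟨l, hl⟩
    · exact hne (hp.trans hq.symm)
    · rw [hp, hl, if_pos rfl, if_neg (Fin.succ_ne_zero l)] at h1
      exact cornerShift_ne hM c d h1.symm
    · rw [hk, hq, if_neg (Fin.succ_ne_zero k), if_pos rfl] at h1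
      exact cornerShift_ne hM c d h1
    · apply hne; rw [hk, hl, Fin.eq_zero k, Fin.eq_zero l]
  exact ofLex.injective (Prod.ext hi h2)

/-- The corner chart as an embedding (`M ≥ 2`). [folklore] -/
def cornerEmb (hM : 2 ≤ M) (c : Fin 2 → Fin M) (d : Fin 2) : Fin 2 ×ₗ FermionTorus 2 2 ↪ FermionTorus 2 (M * 2) :=
  ⟨cornerSite c d, cornerSite_injective hM c d⟩

/-- `cornerEmb` unfolded. [cite: LeBlancEtAl2015, eq. (1)] -/
@[simp] theorem cornerEmb_apply (hM : 2 ≤ M) (c : Fin 2 → Fin M) (d : Fin 2) (p : Fin 2 ×ₗ FermionTorus 2 2) :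
    cornerEmb hM c d p = cellSite (if (ofLex p).1 = 0 then c else cornerShift c d) (ofLex p).2 := rfl

/-- The first copy of a corner window is the plaquette `c`. [folklore] -/
private theorem inlCell_trans_cornerEmb (hM : 2 ≤ M) (c : Fin 2 → Fin M) (d : Fin 2) :
    inlCell.trans (cornerEmb hM c d) = cellEmb c := by
  ext a; simp [Function.Embedding.trans_apply]

/-- The second copy of a corner window is the plaquette `c + (1, ±1)`. [folklore] -/
private theorem inrCell_trans_cornerEmb (hM : 2 ≤ M) (c : Fin 2 → Fin M) (d : Fin 2) :
    inrCell.trans (cornerEmb hM c d) = cellEmb (cornerShift c d) := by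
  ext a; simp [Function.Embedding.trans_apply]

end Charts

/-! ### §2. Plaquette steps and torus coordinates on representatives -/

section Val

variable [NeZero M]

/-- `y = x + 1` in `ℤ/M` (`M ≥ 2`) on representatives: `y = x + 1` in `ℕ`, or the wrap-around
`x = M - 1`, `y = 0`. [folklore] -/
private theorem fin_eq_add_one_iff_val (hM : 2 ≤ M) (x y : Fin M) :
    y = x + 1 ↔ ((y : ℕ) = x + 1 ∨ ((x : ℕ) + 1 = M ∧ (y : ℕ) = 0)) := by
  rw [Fin.ext_iff, Fin.val_add, Fin.val_one', Nat.mod_eq_of_lt (by omega : 1 < M)]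
  rcases Nat.lt_or_ge ((x : ℕ) + 1) M with h | h
  · rw [Nat.mod_eq_of_lt h]; omega
  · rw [show (x : ℕ) + 1 = M by omega, Nat.mod_self]; omega

/-- `y = x - 1` in `ℤ/M` (`M ≥ 2`) on representatives. [folklore] -/
private theorem fin_eq_sub_one_iff_val (hM : 2 ≤ M) (x y : Fin M) :
    y = x - 1 ↔ ((x : ℕ) = y + 1 ∨ ((y : ℕ) + 1 = M ∧ (x : ℕ) = 0)) := by
  rw [eq_sub_iff_add_eq, show (y + 1 = x ↔ x = y + 1) from eq_comm]
  exact fin_eq_add_one_iff_val hM y x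

omit [NeZero M] in
/-- Equality of plaquette indices on representatives. [folklore] -/
private theorem cell_eq_iff_val (c c' : Fin 2 → Fin M) : c' = c ↔ (c' 0 : ℕ) = c 0 ∧ (c' 1 : ℕ) = c 1 := by
  rw [funext_iff, Fin.forall_fin_two, Fin.ext_iff, Fin.ext_iff]

/-- `c' = c + e₀` on representatives. [folklore] -/
private theorem eq_shiftCell_zero_iff_val (hM : 2 ≤ M) (c c' : Fin 2 → Fin M) :
    c' = shiftCell c 0 ↔ ((c' 0 : ℕ) = c 0 + 1 ∨ ((c 0 : ℕ) + 1 = M ∧ (c' 0 : ℕ) = 0)) ∧ (c' 1 : ℕ) = c 1 := by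
  rw [funext_iff, Fin.forall_fin_two, shiftCell, Pi.add_apply, Pi.add_apply, Pi.single_eq_same,
    Pi.single_eq_of_ne (by decide : (1 : Fin 2) ≠ 0), add_zero, fin_eq_add_one_iff_val hM, Fin.ext_iff (a := c' 1)]

/-- `c' = c + e₁` on representatives. [folklore] -/
private theorem eq_shiftCell_one_iff_val (hM : 2 ≤ M) (c c' : Fin 2 → Fin M) :
    c' = shiftCell c 1 ↔ (c' 0 : ℕ) = c 0 ∧ ((c' 1 : ℕ) = c 1 + 1 ∨ ((c 1 : ℕ) + 1 = M ∧ (c' 1 : ℕ) = 0)) := by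
  rw [funext_iff, Fin.forall_fin_two, shiftCell, Pi.add_apply, Pi.add_apply, Pi.single_eq_same,
    Pi.single_eq_of_ne (by decide : (0 : Fin 2) ≠ 1), add_zero, fin_eq_add_one_iff_val hM, Fin.ext_iff (a := c' 0)]

/-- `c' = c + (1, 1)` on representatives. [folklore] -/
private theorem eq_cornerShift_zero_iff_val (hM : 2 ≤ M) (c c' : Fin 2 → Fin M) :
    c' = cornerShift c 0 ↔
      ((c' 0 : ℕ) = c 0 + 1 ∨ ((c 0 : ℕ) + 1 = M ∧ (c' 0 : ℕ) = 0)) ∧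
        ((c' 1 : ℕ) = c 1 + 1 ∨ ((c 1 : ℕ) + 1 = M ∧ (c' 1 : ℕ) = 0)) := by
  rw [funext_iff, Fin.forall_fin_two, cornerShift_apply_zero, cornerShift_zero_apply_one, fin_eq_add_one_iff_val hM,
    fin_eq_add_one_iff_val hM]

/-- `c' = c + (1, -1)` on representatives. [folklore] -/
private theorem eq_cornerShift_one_iff_val (hM : 2 ≤ M) (c c' : Fin 2 → Fin M) :
    c' = cornerShift c 1 ↔
      ((c' 0 : ℕ) = c 0 + 1 ∨ ((c 0 : ℕ) + 1 = M ∧ (c' 0 : ℕ) = 0)) ∧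
        ((c 1 : ℕ) = c' 1 + 1 ∨ ((c' 1 : ℕ) + 1 = M ∧ (c 1 : ℕ) = 0)) := by
  rw [funext_iff, Fin.forall_fin_two, cornerShift_apply_zero, cornerShift_one_apply_one, fin_eq_add_one_iff_val hM,
    fin_eq_sub_one_iff_val hM]

omit [NeZero M] in
/-- One torus coordinate `u = a + 2c ∈ ℤ/2M` in cell form: `v = u + 1` on representatives (`M ≥ 1` is
automatic from `c : Fin M`). [folklore] -/
private theorem cast_cell_eq_add_one_iff_val (c c' : Fin M) (a b : Fin 2) :
    ((((finProdFinEquiv (c', b) : Fin (M * 2)) : ℕ) : ZMod (M * 2)) =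
        (((finProdFinEquiv (c, a) : Fin (M * 2)) : ℕ) : ZMod (M * 2)) + 1) ↔
      ((b : ℕ) + 2 * c' = a + 2 * c + 1 ∨ ((a : ℕ) + 2 * c + 1 = M * 2 ∧ (b : ℕ) + 2 * c' = 0)) := by
  have ha := a.isLt; have hb := b.isLt; have hc := c.isLt; have hc' := c'.isLt
  have hcast : (((finProdFinEquiv (c, a) : Fin (M * 2)) : ℕ) : ZMod (M * 2)) + 1 =
      ((((finProdFinEquiv (c, a) : Fin (M * 2)) : ℕ) + 1 : ℕ) : ZMod (M * 2)) := by push_cast; rfl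
  rw [hcast, ZMod.natCast_eq_natCast_iff', Nat.mod_eq_of_lt (finProdFinEquiv (c', b)).isLt]
  simp only [finProdFinEquiv_apply_val]
  have hmod : ((a : ℕ) + 2 * c + 1) % (M * 2) =
      if (a : ℕ) + 2 * c + 1 < M * 2 then (a : ℕ) + 2 * c + 1 else 0 := by
    split_ifs with h
    · exact Nat.mod_eq_of_lt h
    · rw [show (a : ℕ) + 2 * c + 1 = M * 2 by omega, Nat.mod_self]
  rw [hmod]
  split_ifs with h <;> omega

omit [NeZero M] in
/-- One torus coordinate in cell form: equality on representatives. [folklore] -/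
private theorem cast_cell_eq_iff_val (c c' : Fin M) (a b : Fin 2) :
    ((((finProdFinEquiv (c', b) : Fin (M * 2)) : ℕ) : ZMod (M * 2)) =
        (((finProdFinEquiv (c, a) : Fin (M * 2)) : ℕ) : ZMod (M * 2))) ↔ (b : ℕ) + 2 * c' = a + 2 * c := by
  rw [ZMod.natCast_eq_natCast_iff', Nat.mod_eq_of_lt (finProdFinEquiv (c', b)).isLt,
    Nat.mod_eq_of_lt (finProdFinEquiv (c, a)).isLt]
  simp only [finProdFinEquiv_apply_val]

omit [NeZero M] in
/-- One torus coordinate in cell form: `v = u + (-1)` iff `u = v + 1`, on representatives. [folklore] -/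
private theorem cast_cell_eq_add_neg_one_iff_val (c c' : Fin M) (a b : Fin 2) :
    ((((finProdFinEquiv (c', b) : Fin (M * 2)) : ℕ) : ZMod (M * 2)) =
        (((finProdFinEquiv (c, a) : Fin (M * 2)) : ℕ) : ZMod (M * 2)) + -1) ↔
      ((a : ℕ) + 2 * c = b + 2 * c' + 1 ∨ ((b : ℕ) + 2 * c' + 1 = M * 2 ∧ (a : ℕ) + 2 * c = 0)) := by
  rw [eq_add_neg_iff_add_eq, show ((((finProdFinEquiv (c', b) : Fin (M * 2)) : ℕ) : ZMod (M * 2)) + 1 =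
      (((finProdFinEquiv (c, a) : Fin (M * 2)) : ℕ) : ZMod (M * 2)) ↔
      (((finProdFinEquiv (c, a) : Fin (M * 2)) : ℕ) : ZMod (M * 2)) =
      (((finProdFinEquiv (c', b) : Fin (M * 2)) : ℕ) : ZMod (M * 2)) + 1) from eq_comm]
  exact cast_cell_eq_add_one_iff_val c' c b a

/-- The first component of both diagonal jumps is `1`. [folklore] -/
@[simp] private theorem torusDiagJump_apply_zero (L : ℕ) (s : Fin 2) : torusDiagJump L s 0 = 1 := by
  simp [torusDiagJump]

/-- The second component of the jump `e₁ + e₂` is `1`. [folklore] -/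
@[simp] private theorem torusDiagJump_zero_apply_one (L : ℕ) : torusDiagJump L 0 1 = 1 := by
  simp [torusDiagJump]

/-- The second component of the jump `e₁ - e₂` is `-1`. [folklore] -/
@[simp] private theorem torusDiagJump_one_apply_one (L : ℕ) : torusDiagJump L 1 1 = -1 := by
  simp [torusDiagJump]

omit [NeZero M] in
/-- **Diagonal adjacency of the torus `(ℤ/2M)²` in cell coordinates**: the statistical-mechanics
coordinates of the two cell sites differ, and one is a diagonal jump `±(e₁ + e₂)`, `±(e₁ - e₂)` of the
other (`fermionTorusDiagGraph` is the pull-back of `torusDiagGraph = fromRel (y = x + jump)`). [folklore] -/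
private theorem diagAdj_cellSite_iff (c c' : Fin 2 → Fin M) (a b : FermionTorus 2 2) :
    (fermionTorusDiagGraph (M * 2)).Adj (cellSite c a) (cellSite c' b) ↔
      FermionTorus.toTorusSite (cellSite c a) ≠ FermionTorus.toTorusSite (cellSite c' b) ∧
        ((∃ s : Fin 2, FermionTorus.toTorusSite (cellSite c' b) =
            FermionTorus.toTorusSite (cellSite c a) + torusDiagJump (M * 2) s) ∨
          ∃ s : Fin 2, FermionTorus.toTorusSite (cellSite c a) =
            FermionTorus.toTorusSite (cellSite c' b) + torusDiagJump (M * 2) s) := by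
  show (torusDiagGraph (M * 2)).Adj _ _ ↔ _
  unfold torusDiagGraph
  exact SimpleGraph.fromRel_adj _ _ _

end Val

/-! ### §3. Diagonal torus adjacency in cell coordinates (pointwise bond partition) -/

section Pointwise

variable [NeZero M] {β : Type*} [AddCommMonoid β]

/-- Every offset of `{0,1}²` is `![a₀, a₁]`. [folklore] -/
private theorem offset_cases_sq (a : FermionTorus 2 2) : ∃ a0 a1 : Fin 2, a = toLex ![a0, a1] :=
  ⟨ofLex a 0, ofLex a 1, ofLex.injective (funext fun i => by fin_cases i <;> rfl)⟩

/-- Adjacency in the plaquette diagonal graph, unfolded. [folklore] -/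
private theorem plaquetteDiagGraph_adj_iff (a b : FermionTorus 2 2) :
    plaquetteDiagGraph.Adj a b ↔ ofLex a 0 ≠ ofLex b 0 ∧ ofLex a 1 ≠ ofLex b 1 := Iff.rfl

/-- Adjacency in the diagonal link graph, unfolded. [folklore] -/
private theorem linkDiagGraph_adj_iff (e : Fin 2) (p q : Fin 2 ×ₗ FermionTorus 2 2) :
    (linkDiagGraph e).Adj p q ↔ ((ofLex p).1 = 0 ∧ (ofLex q).1 = 1 ∧ LinkDiag e (ofLex p).2 (ofLex q).2) ∨
      ((ofLex p).1 = 1 ∧ (ofLex q).1 = 0 ∧ LinkDiag e (ofLex q).2 (ofLex p).2) := Iff.rfl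

/-- Adjacency in the corner link graph, unfolded. [folklore] -/
private theorem cornerGraph_adj_iff (d : Fin 2) (p q : Fin 2 ×ₗ FermionTorus 2 2) :
    (cornerGraph d).Adj p q ↔ ((ofLex p).1 = 0 ∧ (ofLex q).1 = 1 ∧ CornerPair d (ofLex p).2 (ofLex q).2) ∨
      ((ofLex p).1 = 1 ∧ (ofLex q).1 = 0 ∧ CornerPair d (ofLex q).2 (ofLex p).2) := Iff.rfl

set_option maxHeartbeats 1600000 in
/-- **The indicator of diagonal torus adjacency splits over plaquette diagonals, axial-link
diagonals and corner bonds** (pointwise form of the tiling of the next-nearest-neighbour bonds of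
`(ℤ/2M)²`; the alternatives are mutually exclusive for `M ≥ 2`). [folklore] -/
private theorem ite_diagAdj_cellSite_eq (hM : 2 ≤ M) (c c' : Fin 2 → Fin M) (a b : FermionTorus 2 2) (x : β) :
    (if (fermionTorusDiagGraph (M * 2)).Adj (cellSite c a) (cellSite c' b) then x else 0) =
      (if c' = c ∧ plaquetteDiagGraph.Adj a b then x else 0) +
        ∑ e : Fin 2, ((if c' = shiftCell c e ∧ LinkDiag e a b then x else 0) +
          (if c = shiftCell c' e ∧ LinkDiag e b a then x else 0)) +
        ∑ d : Fin 2, ((if c' = cornerShift c d ∧ CornerPair d a b then x else 0) +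
          (if c = cornerShift c' d ∧ CornerPair d b a then x else 0)) := by
  obtain ⟨a0, a1, rfl⟩ := offset_cases_sq a
  obtain ⟨b0, b1, rfl⟩ := offset_cases_sq b
  have h1 := (c 0).isLt; have h2 := (c 1).isLt; have h1' := (c' 0).isLt; have h2' := (c' 1).isLt
  simp only [Fin.sum_univ_two, Fin.isValue]
  simp only [eq_shiftCell_zero_iff_val hM, eq_shiftCell_one_iff_val hM, eq_cornerShift_zero_iff_val hM,
    eq_cornerShift_one_iff_val hM]
  simp only [cell_eq_iff_val]
  simp only [diagAdj_cellSite_iff, ne_eq, funext_iff, Fin.forall_fin_two, Fin.exists_fin_two,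
    Pi.add_apply, toTorusSite_cellSite, torusDiagJump_apply_zero, torusDiagJump_zero_apply_one,
    torusDiagJump_one_apply_one, cast_cell_eq_add_one_iff_val, cast_cell_eq_iff_val, cast_cell_eq_add_neg_one_iff_val,
    plaquetteDiagGraph_adj_iff, LinkDiag, CornerPair, Fin.isValue, ofLex_toLex, Matrix.cons_val_zero,
    Matrix.cons_val_one]
  fin_cases a0 <;> fin_cases a1 <;> fin_cases b0 <;> fin_cases b1 <;> simp [-Fin.val_eq_zero_iff] <;>
    (try split_ifs) <;> (try intros) <;> first | rfl | (simp only [add_zero, zero_add]; done) | (exfalso; omega)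

end Pointwise

/-! ### §4. Tiling of the diagonal torus bonds -/

section Sums

variable [NeZero M] {β : Type*} [AddCommMonoid β]

/-- The previous diagonal plaquette index `c - (1, ±1)`. [folklore] -/
private theorem eq_cornerShift_iff (c c' : Fin 2 → Fin M) (d : Fin 2) :
    c = cornerShift c' d ↔ c' = c - cornerDir d := by
  rw [cornerShift, eq_sub_iff_add_eq, eq_comm]

omit [NeZero M] in
/-- Collapsing the plaquette sum on the cell terms `[c' = c ∧ Q b]`. [folklore] -/
private theorem sum_ite_eq_and_sq (c : Fin 2 → Fin M) (Q : FermionTorus 2 2 → Prop) [DecidablePred Q]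
    (G : (Fin 2 → Fin M) → FermionTorus 2 2 → β) :
    (∑ c' : Fin 2 → Fin M, ∑ b : FermionTorus 2 2, if c' = c ∧ Q b then G c' b else 0) =
      ∑ b : FermionTorus 2 2, if Q b then G c b else 0 := by
  rw [Finset.sum_comm]
  refine Finset.sum_congr rfl fun b _ => ?_
  simp only [ite_and]
  rw [Finset.sum_ite_eq' univ c, if_pos (mem_univ _)]

omit [NeZero M] in
/-- Collapsing the plaquette sum on link terms `[R c' e ∧ L e b]` when `R c' e ↔ c' = g e`.
[folklore] -/
private theorem sum_ite_rel_and_sq (R : (Fin 2 → Fin M) → Fin 2 → Prop) [∀ c' e, Decidable (R c' e)]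
    (g : Fin 2 → (Fin 2 → Fin M)) (hR : ∀ c' e, R c' e ↔ c' = g e)
    (L : Fin 2 → FermionTorus 2 2 → Prop) [∀ e b, Decidable (L e b)]
    (G : (Fin 2 → Fin M) → FermionTorus 2 2 → β) :
    (∑ c' : Fin 2 → Fin M, ∑ b : FermionTorus 2 2, ∑ e : Fin 2, if R c' e ∧ L e b then G c' b else 0) =
      ∑ e : Fin 2, ∑ b : FermionTorus 2 2, if L e b then G (g e) b else 0 := by
  rw [sum_sum_sum_comm]
  refine Finset.sum_congr rfl fun e _ => ?_
  rw [Finset.sum_comm]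
  refine Finset.sum_congr rfl fun b _ => ?_
  simp only [hR, ite_and]
  rw [Finset.sum_ite_eq' univ (g e), if_pos (mem_univ _)]

/-- The diagonal bonds starting at a fixed site, in cell coordinates: plaquette diagonals, diagonal
bonds to the next / previous axial plaquette `c ± e`, corner bonds to the next / previous diagonal
plaquette `c ± (1, ±1)`. [folklore] -/
private theorem sum_ite_diagAdj_cellSite_eq (hM : 2 ≤ M)
    (X : FermionTorus 2 (M * 2) → FermionTorus 2 (M * 2) → β) (c : Fin 2 → Fin M) (a : FermionTorus 2 2) :
    (∑ y, if (fermionTorusDiagGraph (M * 2)).Adj (cellSite c a) y then X (cellSite c a) y else 0) =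
      (∑ b : FermionTorus 2 2, if plaquetteDiagGraph.Adj a b then X (cellSite c a) (cellSite c b) else 0) +
        ∑ e : Fin 2, ((∑ b : FermionTorus 2 2,
            if LinkDiag e a b then X (cellSite c a) (cellSite (shiftCell c e) b) else 0) +
          ∑ b : FermionTorus 2 2,
            if LinkDiag e b a then X (cellSite c a) (cellSite (c - Pi.single e 1) b) else 0) +
        ∑ d : Fin 2, ((∑ b : FermionTorus 2 2,
            if CornerPair d a b then X (cellSite c a) (cellSite (cornerShift c d) b) else 0) +
          ∑ b : FermionTorus 2 2,
            if CornerPair d b a then X (cellSite c a) (cellSite (c - cornerDir d) b) else 0) := by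
  rw [sum_cellSite]
  simp_rw [ite_diagAdj_cellSite_eq hM]
  simp only [Finset.sum_add_distrib]
  rw [sum_ite_eq_and_sq c _ fun c' b => X (cellSite c a) (cellSite c' b),
    sum_ite_rel_and_sq (fun c' e => c' = shiftCell c e) (fun e => shiftCell c e) (fun _ _ => Iff.rfl) _
      fun c' b => X (cellSite c a) (cellSite c' b),
    sum_ite_rel_and_sq (fun c' e => c = shiftCell c' e) (fun e => c - Pi.single e 1) (fun c' e => eq_shiftCell_iff c c' e)
      (fun e b => LinkDiag e b a) fun c' b => X (cellSite c a) (cellSite c' b),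
    sum_ite_rel_and_sq (fun c' d => c' = cornerShift c d) (fun d => cornerShift c d) (fun _ _ => Iff.rfl) _
      fun c' b => X (cellSite c a) (cellSite c' b),
    sum_ite_rel_and_sq (fun c' d => c = cornerShift c' d) (fun d => c - cornerDir d)
      (fun c' d => eq_cornerShift_iff c c' d)
      (fun d b => CornerPair d b a) fun c' b => X (cellSite c a) (cellSite c' b)]

/-- Sums over the window `{0,1} × {0,1}²` in copy coordinates. [folklore] -/
private theorem sum_window_sq (g : Fin 2 ×ₗ FermionTorus 2 2 → β) :
    ∑ p, g p = ∑ i : Fin 2, ∑ a : FermionTorus 2 2, g (toLex (i, a)) := by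
  rw [← (toLex : Fin 2 × FermionTorus 2 2 ≃ Fin 2 ×ₗ FermionTorus 2 2).sum_comp, Fintype.sum_prod_type]

/-- Sums over the window against the diagonal link graph: the two diagonal bonds, in both
orientations. [folklore] -/
private theorem sum_ite_linkDiagGraph_eq_sq (e : Fin 2) (Y : Fin 2 ×ₗ FermionTorus 2 2 → Fin 2 ×ₗ FermionTorus 2 2 → β) :
    ∑ p, ∑ q, (if (linkDiagGraph e).Adj p q then Y p q else 0) =
      (∑ a : FermionTorus 2 2, ∑ b : FermionTorus 2 2,
          if LinkDiag e a b then Y (toLex (0, a)) (toLex (1, b)) else 0) +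
        ∑ a : FermionTorus 2 2, ∑ b : FermionTorus 2 2,
          if LinkDiag e b a then Y (toLex (1, a)) (toLex (0, b)) else 0 := by
  rw [sum_window_sq]
  have hinner : ∀ i a, (∑ q, if (linkDiagGraph e).Adj (toLex (i, a)) q then Y (toLex (i, a)) q else 0) =
      ∑ j : Fin 2, ∑ b : FermionTorus 2 2,
        if (linkDiagGraph e).Adj (toLex (i, a)) (toLex (j, b)) then Y (toLex (i, a)) (toLex (j, b)) else 0 :=
    fun i a => sum_window_sq _
  simp_rw [hinner]
  simp only [linkDiagGraph_adj_iff, ofLex_toLex, Fin.sum_univ_two, Fin.isValue]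
  simp

/-- Sums over the window against the corner link graph: the corner bond, in both orientations.
[folklore] -/
private theorem sum_ite_cornerGraph_eq_sq (d : Fin 2) (Y : Fin 2 ×ₗ FermionTorus 2 2 → Fin 2 ×ₗ FermionTorus 2 2 → β) :
    ∑ p, ∑ q, (if (cornerGraph d).Adj p q then Y p q else 0) =
      (∑ a : FermionTorus 2 2, ∑ b : FermionTorus 2 2,
          if CornerPair d a b then Y (toLex (0, a)) (toLex (1, b)) else 0) +
        ∑ a : FermionTorus 2 2, ∑ b : FermionTorus 2 2,
          if CornerPair d b a then Y (toLex (1, a)) (toLex (0, b)) else 0 := by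
  rw [sum_window_sq]
  have hinner : ∀ i a, (∑ q, if (cornerGraph d).Adj (toLex (i, a)) q then Y (toLex (i, a)) q else 0) =
      ∑ j : Fin 2, ∑ b : FermionTorus 2 2,
        if (cornerGraph d).Adj (toLex (i, a)) (toLex (j, b)) then Y (toLex (i, a)) (toLex (j, b)) else 0 :=
    fun i a => sum_window_sq _
  simp_rw [hinner]
  simp only [cornerGraph_adj_iff, ofLex_toLex, Fin.sum_univ_two, Fin.isValue]
  simp

/-- **Tiling of the diagonal torus bonds** (iterated form): a sum over the ordered next-nearest-neighbour
pairs of `(ℤ/2M)²` is the sum over the ordered plaquette diagonals plus, for every plaquette `c` and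
direction `e`, the two diagonal bonds to the plaquette `c + e`, plus, for every plaquette `c` and kind `d`,
the corner bond to the plaquette `c + (1, ±1)` (all in both orientations). [folklore] -/
private theorem sum_ite_diagAdj_eq_iter (hM : 2 ≤ M) (X : FermionTorus 2 (M * 2) → FermionTorus 2 (M * 2) → β) :
    ∑ x, ∑ y, (if (fermionTorusDiagGraph (M * 2)).Adj x y then X x y else 0) =
      ∑ c : Fin 2 → Fin M, ∑ a : FermionTorus 2 2, ∑ b : FermionTorus 2 2,
          (if plaquetteDiagGraph.Adj a b then X (cellSite c a) (cellSite c b) else 0) +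
        ∑ c : Fin 2 → Fin M, ∑ e : Fin 2,
          ((∑ a : FermionTorus 2 2, ∑ b : FermionTorus 2 2,
              if LinkDiag e a b then X (cellSite c a) (cellSite (shiftCell c e) b) else 0) +
            ∑ a : FermionTorus 2 2, ∑ b : FermionTorus 2 2,
              if LinkDiag e b a then X (cellSite (shiftCell c e) a) (cellSite c b) else 0) +
        ∑ c : Fin 2 → Fin M, ∑ d : Fin 2,
          ((∑ a : FermionTorus 2 2, ∑ b : FermionTorus 2 2,
              if CornerPair d a b then X (cellSite c a) (cellSite (cornerShift c d) b) else 0) +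
            ∑ a : FermionTorus 2 2, ∑ b : FermionTorus 2 2,
              if CornerPair d b a then X (cellSite (cornerShift c d) a) (cellSite c b) else 0) := by
  rw [sum_cellSite]
  simp_rw [sum_ite_diagAdj_cellSite_eq hM X]
  simp only [Finset.sum_add_distrib]
  congr 1
  · congr 1
    congr 1
    · refine Finset.sum_congr rfl fun c _ => ?_
      rw [Finset.sum_comm]
    · rw [sum_sum_sum_comm]
      conv_rhs => rw [Finset.sum_comm]
      refine Finset.sum_congr rfl fun e _ => ?_
      rw [← Equiv.sum_comp (Equiv.addRight (Pi.single e (1 : Fin M)))]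
      refine Finset.sum_congr rfl fun c _ => ?_
      simp only [Equiv.coe_addRight, add_sub_cancel_right]
      rfl
  · congr 1
    · refine Finset.sum_congr rfl fun c _ => ?_
      rw [Finset.sum_comm]
    · rw [sum_sum_sum_comm]
      conv_rhs => rw [Finset.sum_comm]
      refine Finset.sum_congr rfl fun d _ => ?_
      rw [← Equiv.sum_comp (Equiv.addRight (cornerDir (M := M) d))]
      refine Finset.sum_congr rfl fun c _ => ?_
      simp only [Equiv.coe_addRight, add_sub_cancel_right]
      rfl

/-- **Tiling of the diagonal torus bonds** (window form): the diagonal bonds of the axial link `(c, e)`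
are the edges of `linkDiagGraph e` on the window `linkEmb hM c e`, the corner bond of the corner link
`(c, d)` is the edge of `cornerGraph d` on the window `cornerEmb hM c d`. [folklore] -/
private theorem sum_ite_diagAdj_eq (hM : 2 ≤ M) (X : FermionTorus 2 (M * 2) → FermionTorus 2 (M * 2) → β) :
    ∑ x, ∑ y, (if (fermionTorusDiagGraph (M * 2)).Adj x y then X x y else 0) =
      ∑ c : Fin 2 → Fin M, ∑ a : FermionTorus 2 2, ∑ b : FermionTorus 2 2,
          (if plaquetteDiagGraph.Adj a b then X (cellSite c a) (cellSite c b) else 0) +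
        ∑ ℓ : (Fin 2 → Fin M) × Fin 2, ∑ p, ∑ q,
          (if (linkDiagGraph ℓ.2).Adj p q then X (linkEmb hM ℓ.1 ℓ.2 p) (linkEmb hM ℓ.1 ℓ.2 q) else 0) +
        ∑ ℓ : (Fin 2 → Fin M) × Fin 2, ∑ p, ∑ q,
          (if (cornerGraph ℓ.2).Adj p q then X (cornerEmb hM ℓ.1 ℓ.2 p) (cornerEmb hM ℓ.1 ℓ.2 q) else 0) := by
  rw [sum_ite_diagAdj_eq_iter hM X, Fintype.sum_prod_type (fun ℓ : (Fin 2 → Fin M) × Fin 2 => ∑ p, ∑ q,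
    (if (linkDiagGraph ℓ.2).Adj p q then X (linkEmb hM ℓ.1 ℓ.2 p) (linkEmb hM ℓ.1 ℓ.2 q) else 0)),
    Fintype.sum_prod_type (fun ℓ : (Fin 2 → Fin M) × Fin 2 => ∑ p, ∑ q,
    (if (cornerGraph ℓ.2).Adj p q then X (cornerEmb hM ℓ.1 ℓ.2 p) (cornerEmb hM ℓ.1 ℓ.2 q) else 0))]
  congr 1
  · congr 1
    refine Finset.sum_congr rfl fun c _ => Finset.sum_congr rfl fun e _ => ?_
    rw [sum_ite_linkDiagGraph_eq_sq]
    simp only [linkEmb_apply, ofLex_toLex, Fin.isValue, ↓reduceIte, one_ne_zero]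
  · refine Finset.sum_congr rfl fun c _ => Finset.sum_congr rfl fun d _ => ?_
    rw [sum_ite_cornerGraph_eq_sq]
    simp only [cornerEmb_apply, ofLex_toLex, Fin.isValue, ↓reduceIte, one_ne_zero]

end Sums

/-! ### §5. The bond partition of the square-torus `t–t'` Hamiltonian -/

/-- **Bond partition of the `t–t'` Hamiltonian of the square torus `(ℤ/2M)²`** (`M ≥ 2`):
`H = Σ_c Γ(cellEmb c)(H_plaq(t,U) + D_plaq(t')) + (Σ_{(c,e)} Γ(linkEmb c e)(T_e(t) + D_e(t'))
  + Σ_{(c,d)} Γ(cornerEmb c d) C_d(t'))`, with `H_plaq = hamiltonian plaquetteGraph t U`,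
`D_plaq = hamiltonian plaquetteDiagGraph t' 0`, `T_e = hamiltonian (linkGraph e) t 0`,
`D_e = hamiltonian (linkDiagGraph e) t' 0`, `C_d = hamiltonian (cornerGraph d) t' 0`. [folklore] -/
private theorem diag_hamiltonian_eq_sum_cells_add_sum_links [NeZero M] (hM : 2 ≤ M) (t' : ℝ) :
    hamiltonian (fermionTorusDiagGraph (M * 2)) t' 0 =
      ∑ c : Fin 2 → Fin M, fermionEmbed (cellEmb c) (hamiltonian plaquetteDiagGraph t' 0) +
        (∑ ℓ : (Fin 2 → Fin M) × Fin 2, fermionEmbed (linkEmb hM ℓ.1 ℓ.2) (hamiltonian (linkDiagGraph ℓ.2) t' 0) +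
          ∑ ℓ : (Fin 2 → Fin M) × Fin 2, fermionEmbed (cornerEmb hM ℓ.1 ℓ.2) (hamiltonian (cornerGraph ℓ.2) t' 0)) := by
  simp_rw [fermionEmbed_hamiltonian, Complex.ofReal_zero, zero_smul, add_zero]
  rw [← Finset.smul_sum, ← Finset.smul_sum, ← Finset.smul_sum, ← smul_add, ← smul_add, hamiltonian,
    Complex.ofReal_zero, zero_smul, add_zero]
  congr 1
  simp_rw [sum_ite_const_cond]
  rw [sum_ite_diagAdj_eq hM, add_assoc]
  simp only [cellEmb_apply]

/-- **Bond partition of the `t–t'` Hamiltonian of the square torus `(ℤ/2M)²`** (`M ≥ 2`):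
`H = Σ_c Γ(cellEmb c)(H_plaq(t,U) + D_plaq(t')) + (Σ_{(c,e)} Γ(linkEmb c e)(T_e(t) + D_e(t'))
  + Σ_{(c,d)} Γ(cornerEmb c d) C_d(t'))`, with `H_plaq = hamiltonian plaquetteGraph t U`,
`D_plaq = hamiltonian plaquetteDiagGraph t' 0`, `T_e = hamiltonian (linkGraph e) t 0`,
`D_e = hamiltonian (linkDiagGraph e) t' 0`, `C_d = hamiltonian (cornerGraph d) t' 0` (the nearest-neighbour
half is the square file's `hamiltonian_eq_sum_cells_add_sum_links`). [cite: LeBlancEtAl2015, eq. (1)] -/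
theorem torusTT'_hamiltonian_eq_sum_cells_add_sum_links [NeZero M] (hM : 2 ≤ M) (t t' U : ℝ) :
    hubbardTorusTT' (M * 2) t t' U =
      ∑ c : Fin 2 → Fin M, fermionEmbed (cellEmb c)
          (hamiltonian plaquetteGraph t U + hamiltonian plaquetteDiagGraph t' 0) +
        (∑ ℓ : (Fin 2 → Fin M) × Fin 2, fermionEmbed (linkEmb hM ℓ.1 ℓ.2)
            (hamiltonian (linkGraph ℓ.2) t 0 + hamiltonian (linkDiagGraph ℓ.2) t' 0) +
          ∑ ℓ : (Fin 2 → Fin M) × Fin 2, fermionEmbed (cornerEmb hM ℓ.1 ℓ.2)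
            (hamiltonian (cornerGraph ℓ.2) t' 0)) := by
  rw [hubbardTorusTT', hamiltonian_eq_sum_cells_add_sum_links hM t U,
    diag_hamiltonian_eq_sum_cells_add_sum_links hM t']
  simp only [fermionEmbed_add, Finset.sum_add_distrib]
  abel

/-! ### §6. The bound -/

set_option maxHeartbeats 800000 in
/-- **The plaquette-dressed Slater (local-unitary-cluster) bound on the square torus `(ℤ/2M)²` with
`t–t'` hopping, `M ≥ 2`.** For all real `t, t', U`, every orthogonal projection `P` on the one-particle
space of the torus with `tr P = N`, and every family of particle-number conserving unitaries `u_c` of the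
plaquette Fock space (`u_cᴴ u_c = 1`, `[N̂, u_c] = 0`),
`E_{(ℤ/2M)²}(t,t',U;N) ≤ Re [ Σ_c Σ_{s,t} (u_cᴴ (H_plaq + D_plaq) u_c)_{st} · slaterRDM (P|_{cell c}) s t
   + Σ_{(c,e)} Σ_{s,t} (V_{c,e}ᴴ (T_e + D_e) V_{c,e})_{st} · slaterRDM (P|_{linkEmb c e}) s t
   + Σ_{(c,d)} Σ_{s,t} (W_{c,d}ᴴ C_d W_{c,d})_{st} · slaterRDM (P|_{cornerEmb c d}) s t ]`,
`V_{c,e} = Γ(inlCell) u_c · Γ(inrCell) u_{c+e}`, `W_{c,d} = Γ(inlCell) u_c · Γ(inrCell) u_{c+(1,±1)}`: the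
energy of the dressed Slater determinant `(∏_c Γ(cellEmb c) u_c) Φ_P`, an explicit polynomial in the window
entries of `P` and the entries of the `u_c` (`DressedCluster.groundEnergy_le` + the bond partition). At
`t' = 0` the diagonal window operators vanish and this is the square file's `groundEnergyAt_le_dressed`;
it is the square-presentation twin of `groundEnergy_rectTT'_le_dressed`. [cite: BachLiebSolovej1994, eq. (2c.36)] -/
theorem groundEnergy_torusTT'_le_dressed [NeZero M] (hM : 2 ≤ M) (t t' U : ℝ)
    {P : Matrix (Orb (FermionTorus 2 (M * 2))) (Orb (FermionTorus 2 (M * 2))) ℂ}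
    (hP : P.IsHermitian) (hPP : P * P = P) {N : ℕ} (htr : P.trace = N)
    (u : (Fin 2 → Fin M) → Matrix (Finset (Orb (FermionTorus 2 2))) (Finset (Orb (FermionTorus 2 2))) ℂ)
    (hu : ∀ c, (u c)ᴴ * u c = 1) (huN : ∀ c, Commute totalNumberOp (u c)) :
    groundEnergy (hubbardTorusTT' (M * 2) t t' U) N ≤
      ((∑ c : Fin 2 → Fin M, ∑ s : Finset (Orb (FermionTorus 2 2)), ∑ s' : Finset (Orb (FermionTorus 2 2)),
          ((u c)ᴴ * (hamiltonian plaquetteGraph t U + hamiltonian plaquetteDiagGraph t' 0) * u c) s s' *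
            HartreeFock.slaterRDM (P.submatrix (fun a => orb (cellEmb c (ofLex a).1) (ofLex a).2)
              (fun a => orb (cellEmb c (ofLex a).1) (ofLex a).2)) s s') +
        (∑ ℓ : (Fin 2 → Fin M) × Fin 2, ∑ s : Finset (Orb (Fin 2 ×ₗ FermionTorus 2 2)),
            ∑ s' : Finset (Orb (Fin 2 ×ₗ FermionTorus 2 2)),
              ((fermionEmbed inlCell (u ℓ.1) * fermionEmbed inrCell (u (shiftCell ℓ.1 ℓ.2)))ᴴ *
                  (hamiltonian (linkGraph ℓ.2) t 0 + hamiltonian (linkDiagGraph ℓ.2) t' 0) *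
                (fermionEmbed inlCell (u ℓ.1) * fermionEmbed inrCell (u (shiftCell ℓ.1 ℓ.2)))) s s' *
              HartreeFock.slaterRDM (P.submatrix (fun a => orb (linkEmb hM ℓ.1 ℓ.2 (ofLex a).1) (ofLex a).2)
                (fun a => orb (linkEmb hM ℓ.1 ℓ.2 (ofLex a).1) (ofLex a).2)) s s' +
          ∑ ℓ : (Fin 2 → Fin M) × Fin 2, ∑ s : Finset (Orb (Fin 2 ×ₗ FermionTorus 2 2)),
            ∑ s' : Finset (Orb (Fin 2 ×ₗ FermionTorus 2 2)),
              ((fermionEmbed inlCell (u ℓ.1) * fermionEmbed inrCell (u (cornerShift ℓ.1 ℓ.2)))ᴴ *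
                  hamiltonian (cornerGraph ℓ.2) t' 0 *
                (fermionEmbed inlCell (u ℓ.1) * fermionEmbed inrCell (u (cornerShift ℓ.1 ℓ.2)))) s s' *
              HartreeFock.slaterRDM (P.submatrix (fun a => orb (cornerEmb hM ℓ.1 ℓ.2 (ofLex a).1) (ofLex a).2)
                (fun a => orb (cornerEmb hM ℓ.1 ℓ.2 (ofLex a).1) (ofLex a).2)) s s')).re := by
  have hH := torusTT'_hamiltonian_eq_sum_cells_add_sum_links hM t t' U
  have h := DressedCluster.groundEnergy_le (φ := cellEmb) (hdisj := fun _ _ h => disjoint_cellEmb h)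
    (u := u) (huN := huN) (D := ((Fin 2 → Fin M) × Fin 2) ⊕ ((Fin 2 → Fin M) × Fin 2))
    (ψ := Sum.elim (fun ℓ => linkEmb hM ℓ.1 ℓ.2) (fun ℓ => cornerEmb hM ℓ.1 ℓ.2))
    (src := Sum.elim (fun ℓ => ℓ.1) (fun ℓ => ℓ.1))
    (tgt := Sum.elim (fun ℓ => shiftCell ℓ.1 ℓ.2) (fun ℓ => cornerShift ℓ.1 ℓ.2))
    (ι₁ := inlCell) (ι₂ := inrCell)
    (hne := by
      rintro (ℓ | ℓ)
      exacts [(shiftCell_ne hM ℓ.1 ℓ.2).symm, (cornerShift_ne hM ℓ.1 ℓ.2).symm])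
    (hsrc := by
      rintro (ℓ | ℓ)
      exacts [inlCell_trans_linkEmb hM ℓ.1 ℓ.2, inlCell_trans_cornerEmb hM ℓ.1 ℓ.2])
    (htgt := by
      rintro (ℓ | ℓ)
      exacts [inrCell_trans_linkEmb hM ℓ.1 ℓ.2, inrCell_trans_cornerEmb hM ℓ.1 ℓ.2])
    (hcover := mem_range_inlCell_or_inrCell)
    hP hPP htr (hu := fun c => by convert hu c) (H := hubbardTorusTT' (M * 2) t t' U)
    (h₁ := fun _ => hamiltonian plaquetteGraph t U + hamiltonian plaquetteDiagGraph t' 0)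
    (h₂ := Sum.elim (fun ℓ => hamiltonian (linkGraph ℓ.2) t 0 + hamiltonian (linkDiagGraph ℓ.2) t' 0)
      (fun ℓ => hamiltonian (cornerGraph ℓ.2) t' 0))
    (by rw [hH]; simp only [Fintype.sum_sum_type, Sum.elim_inl, Sum.elim_inr])
  simp only [Fintype.sum_sum_type, Sum.elim_inl, Sum.elim_inr] at h
  convert h using 3

end PlaquetteLUC

end Literature.MathematicalPhysics.QuantumLattice

end
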